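/-
Copyright (c) 2026 the pub-hodgecm-mathlib formalisation cell (harness21).  Prover seat hodgecm-mathlib-K2Liu-p11 (g0), Track B «K2-LIT»,
#184♮ = hLiu418 = `stmt-HodgeConjecture-24832`; LEAD F0P6-plan (g13) RULINGS M-156n (4)∕M-157i′∕M-157k (A∞ organ, (A-int-arch)∕(A∞-½) faces).
File: UNIQUENESS of the scalar-type vector in the tube frame and the transfer of the A∞ letters to ANY scalar-type section (e.g. the
archimedean Siegel–Weil section of a Gaussian).  THEOREMS ONLY.
-/
import Summits.HodgeConjecture.HodgeConjecture.Theorems.K2LiuArchNormalisingScalar   -- ★ (this seat): letters `c_k`, `Q`, `M*`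
import Summits.HodgeConjecture.HodgeConjecture.Theorems.K2LiuHermitianTubeAction      -- ★ (this seat) H1-C: `U(J) = P_Δ · Stab(i1)`
import HarnessLib

/-!
# Crux `HLiu418`, A∞ organ: a section with the scalar parabolic law and the scalar `K_w`-type IS `f(1) · f⁰_{s,k}`

Cell `hodgecm-mathlib`, crux item hLiu418 = `stmt-HodgeConjecture-24832` (helper lane `--supports`, count-neutral).

The (A-int-arch)∕(A∞-½) faces are stated for the archimedean Siegel–Weil section of a (Gaussian) SW datum; the A∞ letters (★ `c_k`, `Q`, `M*`)
are stated for the frame's scalar-type vector `archScalarSection k s`.  The bridge is UNIQUENESS, proved here WITHOUT multiplicity-one theory,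
from ★ H1-C `exists_transl_levi_mul_stabilizer` (`U(J) = P_Δ · Stab(i1)`):
* §1 `eq_mul_archScalarSection` (generic `l`) — if `f` has the scalar parabolic law `IsArchSiegelSection χ_k s f` and the scalar `K_w`-type
  `f(g u) = j(u,i1)^{−k} f(g)` (`u ∈ Stab(i1)`), then `f g = f 1 · archScalarSection k s g` for every `g ∈ U(J)`;
* §2 (`l = Fin 2`) `archIntertwining_eq_mul_of_scalarType` — hence `M_w(s) f = f(1)·c_k(s)·f⁰_{−s,k}` on `U(2,2)` (`re s > ½`) and
  `archIntertwiningNormalized_eq_of_scalarType_one ∕ _neg_one` — `M*_w(s) f = f(1)·f⁰_{−s,±1}` for the line types `k = ±1`: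
  the (A-int-arch) shape «`M*_σ ∘ sw = c_σ · sw′`» on the Gaussian line, with `c_σ = f(1)` and the target section explicit.
Consumers discharge the two hypotheses for `swSection_{V′,σ}` from ★ p05 `vac_archWeilSectionS_placeSecJ_kV` (K-type) and the SW parabolic law.
References: [Shimura1997, §16.4], [KudlaRallis1994 (citation only)] — derived here.
HONEST LABEL: HC_CM is proved only modulo the 7 printed citations (2 remaining named inputs: hLiu418 = stmt-HodgeConjecture-24832,
h413 = stmt-HodgeConjecture-24833) until rung 0 closes; count-neutral helper, closes no socket.
-/

set_option autoImplicit false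
set_option linter.dupNamespace false

noncomputable section

open Complex MeasureTheory Set Matrix
open scoped ComplexOrder ComplexConjugate

namespace Summit.HodgeConjecture.HodgeConjecture.Cruxes.HLiu418.K2LiuArchScalarSectionUnique

open Literature.NumberTheory.ModularForms.SiegelUpperHalfSpace (num denom moeb num_def denom_def moeb_def)
open Summit.HodgeConjecture.HodgeConjecture.Cruxes.HLiu418.K2LiuHermitianTubeCocycle
open Summit.HodgeConjecture.HodgeConjecture.Cruxes.HLiu418.K2LiuHermitianTubeAction
open Summit.HodgeConjecture.HodgeConjecture.Cruxes.HLiu418.K2LiuArchInducedTubeDefs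
open Summit.HodgeConjecture.HodgeConjecture.Cruxes.HLiu418.K2LiuArchInducedTubeSection
open Summit.HodgeConjecture.HodgeConjecture.Cruxes.HLiu418.K2LiuArchNormalisingScalar

/-! ## §1  Uniqueness of the scalar-type vector (generic rank) -/

section Generic

variable {l : Type*} [Fintype l] [DecidableEq l]

/-- **UNIQUENESS OF THE SCALAR-TYPE VECTOR**: a function on `U(J)` with the scalar parabolic law of `I_w(s, χ_k)` and the scalar
`K_w`-type `j(u,i1)^{−k}` equals `f(1) · f⁰_{s,k}` on `U(J)` (`U(J) = P_Δ·Stab(i1)`, ★ H1-C). [Shimura1997, §16.4] -/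
theorem eq_mul_archScalarSection (k : ℤ) (s : ℂ) {f : Matrix (l ⊕ l) (l ⊕ l) ℂ → ℂ}
    (hP : IsArchSiegelSection (fun z : ℂ => (conj z / ((‖z‖ : ℝ) : ℂ)) ^ k) s f)
    (hK : ∀ g u : Matrix (l ⊕ l) (l ⊕ l) ℂ, gᴴ * Matrix.J l ℂ * g = Matrix.J l ℂ → uᴴ * Matrix.J l ℂ * u = Matrix.J l ℂ →
      moeb u (I • (1 : Matrix l l ℂ)) = I • 1 → f (g * u) = (denom u (I • (1 : Matrix l l ℂ))).det ^ (-k) * f g)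
    {g : Matrix (l ⊕ l) (l ⊕ l) ℂ} (hg : gᴴ * Matrix.J l ℂ * g = Matrix.J l ℂ) :
    f g = f 1 * archScalarSection k s g := by
  obtain ⟨X, R, u, hX, hR, hRu, hu, huI, hgeq⟩ := exists_transl_levi_mul_stabilizer hg
  have hp : (fromBlocks 1 X 0 1 * fromBlocks R 0 0 R⁻¹ : Matrix (l ⊕ l) (l ⊕ l) ℂ)ᴴ * Matrix.J l ℂ *
      (fromBlocks 1 X 0 1 * fromBlocks R 0 0 R⁻¹) = Matrix.J l ℂ := transl_mul_levi_mem hX hR hRu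
  have hp21 : (fromBlocks 1 X 0 1 * fromBlocks R 0 0 R⁻¹ : Matrix (l ⊕ l) (l ⊕ l) ℂ).toBlocks₂₁ = 0 := toBlocks₂₁_transl_mul_levi X R
  have hf := hK _ u hp hu huI
  have hf1 := hP _ 1 hp hp21
  rw [Matrix.mul_one] at hf1
  have ha := archScalarSection_mul_stab k s hp hu huI
  have ha1 := isArchSiegelSection_archScalarSection k s _ 1 hp hp21
  rw [Matrix.mul_one, archScalarSection_one, mul_one] at ha1
  rw [hgeq, hf, hf1, ha, ha1]
  ring

/-- The same with `f(1) = 1`: `f = f⁰_{s,k}` on `U(J)`. -/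
theorem eq_archScalarSection (k : ℤ) (s : ℂ) {f : Matrix (l ⊕ l) (l ⊕ l) ℂ → ℂ}
    (hP : IsArchSiegelSection (fun z : ℂ => (conj z / ((‖z‖ : ℝ) : ℂ)) ^ k) s f)
    (hK : ∀ g u : Matrix (l ⊕ l) (l ⊕ l) ℂ, gᴴ * Matrix.J l ℂ * g = Matrix.J l ℂ → uᴴ * Matrix.J l ℂ * u = Matrix.J l ℂ →
      moeb u (I • (1 : Matrix l l ℂ)) = I • 1 → f (g * u) = (denom u (I • (1 : Matrix l l ℂ))).det ^ (-k) * f g)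
    (h1 : f 1 = 1) {g : Matrix (l ⊕ l) (l ⊕ l) ℂ} (hg : gᴴ * Matrix.J l ℂ * g = Matrix.J l ℂ) :
    f g = archScalarSection k s g := by
  rw [eq_mul_archScalarSection k s hP hK hg, h1, one_mul]

/-- The intertwining integral only sees `U(J)`: for `h ∈ U(J)` and `f = f(1)·f⁰_{s,k}` on `U(J)`,
`M_w(s) f (h) = f(1) · M_w(s) f⁰_{s,k} (h)`. [folklore] -/
theorem archIntertwining_eq_mul (k : ℤ) (s : ℂ) {f : Matrix (l ⊕ l) (l ⊕ l) ℂ → ℂ}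
    (hf : ∀ g : Matrix (l ⊕ l) (l ⊕ l) ℂ, gᴴ * Matrix.J l ℂ * g = Matrix.J l ℂ → f g = f 1 * archScalarSection k s g)
    {h : Matrix (l ⊕ l) (l ⊕ l) ℂ} (hh : hᴴ * Matrix.J l ℂ * h = Matrix.J l ℂ) :
    archIntertwining f h = f 1 * archIntertwining (archScalarSection k s) h := by
  rw [archIntertwining_apply, archIntertwining_apply, ← integral_const_mul]
  refine integral_congr_ae (Filter.Eventually.of_forall fun r => ?_)
  exact hf _ (mul_mem_UJ (J_mul_transl_hermOfReal_mem r) hh)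

end Generic

/-! ## §2  Transfer of the A∞ letters to any scalar-type section (`U(2,2)`) -/

/-- **`M_w(s) f = f(1) · c_k(s) · f⁰_{−s,k}` on `U(2,2)`** for every `f` with the scalar parabolic law and scalar `K_w`-type `k`
(`re s > ½`). [Shimura1997, §16.4; Shimura1982, (1.31)] -/
theorem archIntertwining_eq_mul_of_scalarType (k : ℤ) {s : ℂ} (hs : 1 / 2 < s.re) {f : Matrix (Fin 2 ⊕ Fin 2) (Fin 2 ⊕ Fin 2) ℂ → ℂ}
    (hP : IsArchSiegelSection (fun z : ℂ => (conj z / ((‖z‖ : ℝ) : ℂ)) ^ k) s f)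
    (hK : ∀ g u : Matrix (Fin 2 ⊕ Fin 2) (Fin 2 ⊕ Fin 2) ℂ, gᴴ * Matrix.J (Fin 2) ℂ * g = Matrix.J (Fin 2) ℂ →
      uᴴ * Matrix.J (Fin 2) ℂ * u = Matrix.J (Fin 2) ℂ → moeb u (I • (1 : Matrix (Fin 2) (Fin 2) ℂ)) = I • 1 →
        f (g * u) = (denom u (I • (1 : Matrix (Fin 2) (Fin 2) ℂ))).det ^ (-k) * f g)
    {h : Matrix (Fin 2 ⊕ Fin 2) (Fin 2 ⊕ Fin 2) ℂ} (hh : hᴴ * Matrix.J (Fin 2) ℂ * h = Matrix.J (Fin 2) ℂ) :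
    archIntertwining f h = f 1 * archScalarCoeff k s * archScalarSection k (-s) h := by
  have hf : ∀ g : Matrix (Fin 2 ⊕ Fin 2) (Fin 2 ⊕ Fin 2) ℂ, gᴴ * Matrix.J (Fin 2) ℂ * g = Matrix.J (Fin 2) ℂ →
      f g = f 1 * archScalarSection k s g := fun g hg => eq_mul_archScalarSection (l := Fin 2) k s hP hK hg
  have h1 := archIntertwining_eq_mul (l := Fin 2) k s hf hh
  have h2 := archIntertwining_eq_archScalarCoeff_mul k hs hh
  rw [h1, h2, mul_assoc]

/-- **(A-int-arch) SHAPE ON THE GAUSSIAN LINE, `k = 1`**: `M*_w(s) f = f(1) · f⁰_{−s,1}` on `U(2,2)` for every `f` with the scalar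
parabolic law and `K_w`-type `k = 1` (`re s > ½`, `Q(s) ≠ 0`). [KudlaRallis1994 (citation only)] -/
theorem archIntertwiningNormalized_eq_of_scalarType_one {s : ℂ} (hs : 1 / 2 < s.re) (hQ : archNormalisingScalar s ≠ 0)
    {f : Matrix (Fin 2 ⊕ Fin 2) (Fin 2 ⊕ Fin 2) ℂ → ℂ}
    (hP : IsArchSiegelSection (fun z : ℂ => (conj z / ((‖z‖ : ℝ) : ℂ)) ^ (1 : ℤ)) s f)
    (hK : ∀ g u : Matrix (Fin 2 ⊕ Fin 2) (Fin 2 ⊕ Fin 2) ℂ, gᴴ * Matrix.J (Fin 2) ℂ * g = Matrix.J (Fin 2) ℂ →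
      uᴴ * Matrix.J (Fin 2) ℂ * u = Matrix.J (Fin 2) ℂ → moeb u (I • (1 : Matrix (Fin 2) (Fin 2) ℂ)) = I • 1 →
        f (g * u) = (denom u (I • (1 : Matrix (Fin 2) (Fin 2) ℂ))).det ^ (-(1 : ℤ)) * f g)
    {h : Matrix (Fin 2 ⊕ Fin 2) (Fin 2 ⊕ Fin 2) ℂ} (hh : hᴴ * Matrix.J (Fin 2) ℂ * h = Matrix.J (Fin 2) ℂ) :
    archIntertwiningNormalized s f h = f 1 * archScalarSection 1 (-s) h := by
  have hf : ∀ g : Matrix (Fin 2 ⊕ Fin 2) (Fin 2 ⊕ Fin 2) ℂ, gᴴ * Matrix.J (Fin 2) ℂ * g = Matrix.J (Fin 2) ℂ →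
      f g = f 1 * archScalarSection 1 s g := fun g hg => eq_mul_archScalarSection (l := Fin 2) 1 s hP hK hg
  have h1 := archIntertwining_eq_mul (l := Fin 2) 1 s hf hh
  have h3 := archIntertwiningNormalized_archScalarSection_one hs hQ hh
  rw [archIntertwiningNormalized_apply] at h3 ⊢
  rw [h1, ← h3]
  ring

/-- **(A-int-arch) SHAPE ON THE GAUSSIAN LINE, `k = −1`**: `M*_w(s) f = f(1) · f⁰_{−s,−1}`. [KudlaRallis1994 (citation only)] -/
theorem archIntertwiningNormalized_eq_of_scalarType_neg_one {s : ℂ} (hs : 1 / 2 < s.re) (hQ : archNormalisingScalar s ≠ 0)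
    {f : Matrix (Fin 2 ⊕ Fin 2) (Fin 2 ⊕ Fin 2) ℂ → ℂ}
    (hP : IsArchSiegelSection (fun z : ℂ => (conj z / ((‖z‖ : ℝ) : ℂ)) ^ (-1 : ℤ)) s f)
    (hK : ∀ g u : Matrix (Fin 2 ⊕ Fin 2) (Fin 2 ⊕ Fin 2) ℂ, gᴴ * Matrix.J (Fin 2) ℂ * g = Matrix.J (Fin 2) ℂ →
      uᴴ * Matrix.J (Fin 2) ℂ * u = Matrix.J (Fin 2) ℂ → moeb u (I • (1 : Matrix (Fin 2) (Fin 2) ℂ)) = I • 1 →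
        f (g * u) = (denom u (I • (1 : Matrix (Fin 2) (Fin 2) ℂ))).det ^ (-(-1 : ℤ)) * f g)
    {h : Matrix (Fin 2 ⊕ Fin 2) (Fin 2 ⊕ Fin 2) ℂ} (hh : hᴴ * Matrix.J (Fin 2) ℂ * h = Matrix.J (Fin 2) ℂ) :
    archIntertwiningNormalized s f h = f 1 * archScalarSection (-1) (-s) h := by
  have hf : ∀ g : Matrix (Fin 2 ⊕ Fin 2) (Fin 2 ⊕ Fin 2) ℂ, gᴴ * Matrix.J (Fin 2) ℂ * g = Matrix.J (Fin 2) ℂ →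
      f g = f 1 * archScalarSection (-1) s g := fun g hg => eq_mul_archScalarSection (l := Fin 2) (-1) s hP hK hg
  have h1 := archIntertwining_eq_mul (l := Fin 2) (-1) s hf hh
  have h3 := archIntertwiningNormalized_archScalarSection_neg_one hs hQ hh
  rw [archIntertwiningNormalized_apply] at h3 ⊢
  rw [h1, ← h3]
  ring

end Summit.HodgeConjecture.HodgeConjecture.Cruxes.HLiu418.K2LiuArchScalarSectionUnique

end
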